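import Mathlib.Logic.Equiv.Fin.Basic
import Literature.Computability.Complexity.FPRAS
import Literature.Computability.Complexity.BISDownsetsBlowup
import HarnessLib

/-!
# Lemma 9 of Dyer–Goldberg–Greenhill–Jerrum (2003) on code words

M. Dyer, L. A. Goldberg, C. Greenhill, M. Jerrum, *The relative complexity of approximate counting
problems*, Algorithmica 38 (2003) 471–500 (`DyerEtAl2003`), Lemma 9 ("`#DOWNSETS ≤_AP #BIS`"): the
counting identities of the blow-up, proved for an abstract reflexive relation in
`BISDownsetsBlowup.lean` (`card_indep_div_eq`: `|𝓓| = ⌊|𝓘(B)| / (2^m − 1)^n⌋` once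
`4 · 3^n < 2^m − 1`), transferred to the tree's counting functions on code words (`FPRAS.lean`):
for an implication matrix `M` on `Fin n`,

  `downsetCount ⟨n, M⟩ = ⌊bisCount ⟨2nm, blowupFin M m⟩ / (2^m − 1)^n⌋`

(`downsetCount_encode_eq_bisCount_blowup_div`; with the printed parameters `m = 2n`, `n ≥ 5`:
`downsetCount_encode_eq_bisCount_blowup_div_of_five_le`). Here `matrixRel M` is the reflexive
relation `i ≼ j ⇔ i = j ∨ M j i ≠ 0` whose lower sets are exactly the implication-closed sets
counted by `downsetCount` (so no passage to the partial order of strongly connected components —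
the remark in the proof of Theorem 5 — is needed), and `blowupFin M m` is the (bipartite,
`blowupFin_colorable_two`) blow-up relabelled by `Fin (nm + nm)`.

This is the arithmetic of the single-oracle-call reduction; the oracle transducer and the
accuracy bookkeeping ("as in the proof of Theorem 3", `δ = ε/21`) behind the named fact
`DyerEtAl2003.DownsetsAPReducibleBIS` (`BISDownsets.lean`) are not formalised.
-/

namespace Literature.Computability.Complexity

open _root_.Computability Finset

namespace DyerEtAl2003

/-- The reflexive relation of an implication matrix, `i ≼_M j :⟺ i = j ∨ M j i ≠ 0`, whose lower
sets are exactly the implication-closed sets counted by `downsetCount`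
(`isLowerFinset_matrixRel_iff`). [folklore] -/
def matrixRel {n : ℕ} (M : Fin n → Fin n → ℕ) : Fin n → Fin n → Prop :=
  fun i j => i = j ∨ M j i ≠ 0

/-- `matrixRel M` is decidable. [folklore] -/
instance matrixRel.decidableRel {n : ℕ} (M : Fin n → Fin n → ℕ) : DecidableRel (matrixRel M) :=
  fun i j => inferInstanceAs (Decidable (i = j ∨ M j i ≠ 0))

/-- `matrixRel M` is reflexive (the only property of `≼` the blow-up argument uses). [folklore] -/
theorem matrixRel_refl {n : ℕ} (M : Fin n → Fin n → ℕ) (i : Fin n) : matrixRel M i i :=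
  Or.inl rfl

/-- Lower sets of `matrixRel M` = subsets closed under the implications `i → j`, `M i j ≠ 0`.
[folklore] -/
theorem isLowerFinset_matrixRel_iff {n : ℕ} (M : Fin n → Fin n → ℕ) (D : Finset (Fin n)) :
    IsLowerFinset (matrixRel M) D ↔ ∀ i ∈ D, ∀ j : Fin n, M i j ≠ 0 → j ∈ D := by
  constructor
  · intro h i hi j hij
    exact h (Or.inr hij) hi
  · rintro h a b (rfl | hab) hb
    · exact hb
    · exact h b hb a hab

/-- Relabelling of the blow-up vertices `(Fin n × Fin m) ⊕ (Fin n × Fin m)` by `Fin (nm + nm)`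
(row-major inside each side, `U` before `V`). [folklore] -/
def blowupFinEquiv (n m : ℕ) : BlowupVertex (Fin n) m ≃ Fin (n * m + n * m) :=
  (Equiv.sumCongr finProdFinEquiv finProdFinEquiv).trans finSumFinEquiv

/-- **The `#BIS` instance of Lemma 9 as a graph on `Fin (2nm)`**: the blow-up of `matrixRel M`
with blocks of size `m`, relabelled by `blowupFinEquiv`. [cite: DyerEtAl2003, Lemma 9 (proof)] -/
def blowupFin {n : ℕ} (M : Fin n → Fin n → ℕ) (m : ℕ) : SimpleGraph (Fin (n * m + n * m)) :=
  (blowup (matrixRel M) m).comap (blowupFinEquiv n m).symm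

/-- The relabelled blow-up is bipartite. [cite: DyerEtAl2003, Lemma 9 (proof)] -/
theorem blowupFin_colorable_two {n : ℕ} (M : Fin n → Fin n → ℕ) (m : ℕ) :
    (blowupFin M m).Colorable 2 := by
  obtain ⟨c⟩ := blowup_colorable_two (matrixRel M) m
  exact ⟨SimpleGraph.Coloring.mk (fun v => c ((blowupFinEquiv n m).symm v)) fun hvw => c.valid hvw⟩

/-- Relabelling a graph along an equivalence does not change its number of independent sets
(classical decidability, the form of `bisCount_encode_of_colorable`). [folklore] -/
theorem card_indepSets_comap_equiv {V W : Type} [Fintype V] [Fintype W] (G : SimpleGraph V)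
    (e : V ≃ W) :
    haveI := Classical.decRel G.Adj
    haveI := Classical.decRel (G.comap e.symm).Adj
    (univ.filter fun S : Finset W => ∀ a ∈ S, ∀ b ∈ S, ¬ (G.comap e.symm).Adj a b).card =
      (univ.filter fun S : Finset V => ∀ a ∈ S, ∀ b ∈ S, ¬ G.Adj a b).card := by
  classical
  refine Finset.card_bij' (fun S _ => S.map e.symm.toEmbedding) (fun S _ => S.map e.toEmbedding)
    ?_ ?_ ?_ ?_
  · intro S hS
    simp only [Finset.mem_filter, Finset.mem_univ, true_and, Finset.mem_map_equiv,
      Equiv.symm_symm] at hS ⊢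
    intro a ha b hb hab
    exact hS (e a) ha (e b) hb (by simpa [SimpleGraph.comap_adj] using hab)
  · intro S hS
    simp only [Finset.mem_filter, Finset.mem_univ, true_and, Finset.mem_map_equiv] at hS ⊢
    intro a ha b hb hab
    exact hS _ ha _ hb (by simpa [SimpleGraph.comap_adj] using hab)
  · intro S _
    ext x
    simp [Finset.mem_map_equiv]
  · intro S _
    ext x
    simp [Finset.mem_map_equiv]

/-- **Lemma 9 on code words.** For an implication matrix `M` on `Fin n` and a block size `m` with
`4 · 3^n < 2^m − 1` (e.g. `m = 2n`, `n ≥ 5`, as printed), the number of implication-closed sets is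
the integer quotient of the number of independent sets of the (bipartite) blow-up by `(2^m − 1)^n`:
`downsetCount ⟨n, M⟩ = ⌊bisCount ⟨2nm, blowupFin M m⟩ / (2^m − 1)^n⌋` — the arithmetic of the
single-oracle-call reduction `#DOWNSETS ≤_AP #BIS` (what remains for the named fact
`DownsetsAPReducibleBIS` is the transducer and the accuracy bookkeeping).
[cite: DyerEtAl2003, Lemma 9] -/
theorem downsetCount_encode_eq_bisCount_blowup_div {n : ℕ} (M : Fin n → Fin n → ℕ) {m : ℕ}
    (h : 4 * 3 ^ n < 2 ^ m - 1) :
    downsetCount (encodingNatMatrix.encode ⟨n, M⟩) =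
      bisCount (encodingGraph.encode ⟨n * m + n * m, blowupFin M m⟩) / (2 ^ m - 1) ^ n := by
  classical
  have h1 := card_indepSets_comap_equiv (blowup (matrixRel M) m) (blowupFinEquiv n m)
  have h2 := card_indep_div_eq (matrixRel M) m (matrixRel_refl M) (by simpa using h)
  simp only [Fintype.card_fin] at h2
  have hL : downsetCount (encodingNatMatrix.encode ⟨n, M⟩) =
      (univ.filter fun D : Finset (Fin n) => IsLowerFinset (matrixRel M) D).card := by
    rw [downsetCount_encode_eq_card]
    congr 1
    ext D
    simp only [Finset.mem_filter, Finset.mem_univ, true_and]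
    exact (isLowerFinset_matrixRel_iff M D).symm
  have hR : bisCount (encodingGraph.encode ⟨n * m + n * m, blowupFin M m⟩) =
      (univ.filter fun S : Finset (BlowupVertex (Fin n) m) =>
        IsBlowupIndep (matrixRel M) m S).card := by
    rw [bisCount_encode_of_colorable (blowupFin_colorable_two M m)]
    refine Eq.trans ?_ (h1.trans ?_)
    · congr 1
      ext S
      simp only [Finset.mem_filter, Finset.mem_univ, true_and]
      rfl
    · congr 1
      ext S
      simp only [Finset.mem_filter, Finset.mem_univ, true_and]
      rfl
  rw [hL, hR, h2]

/-- The printed parameters: blocks of size `2n`, `n ≥ 5`. [cite: DyerEtAl2003, Lemma 9] -/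
theorem downsetCount_encode_eq_bisCount_blowup_div_of_five_le {n : ℕ} (hn : 5 ≤ n)
    (M : Fin n → Fin n → ℕ) :
    downsetCount (encodingNatMatrix.encode ⟨n, M⟩) =
      bisCount (encodingGraph.encode ⟨n * (2 * n) + n * (2 * n), blowupFin M (2 * n)⟩) /
        (2 ^ (2 * n) - 1) ^ n :=
  downsetCount_encode_eq_bisCount_blowup_div M (four_mul_three_pow_lt_of_five_le hn)

end DyerEtAl2003

end Literature.Computability.Complexity
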